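import Literature.NumberTheory.LFunctions.DivisorSumCharSqLSeries
import Literature.NumberTheory.LFunctions.ZetaSqReflectionPrinciple
import Literature.NumberTheory.LFunctions.SiegelAbelSummation
import Literature.NumberTheory.LFunctions.NymanBeurlingVectorsOrthogonal
import Mathlib.Analysis.Complex.RemovableSingularity
import HarnessLib

/-!
# An explicit formula for the smoothed logarithmic second moment of `ν = 1 ∗ χ`

Topic `Literature/NumberTheory/LFunctions`. Everything here is PROVED (theorems and definitions
with bodies; no named fact).

Let `χ` be a quadratic Dirichlet character mod `D ≥ 1` (`χ² = 1`, `χ ≠ 1`), `ν(n) = ∑_{d∣n} χ(d)`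
(the tree's `divisorSumChar χ`), `τ(n) = d(n)` the divisor function (the tree's `ZetaM4.dCoeff`),
and for `X > 0` put `W_f(X) := ∑_{n ≥ 1} f(n) n^{-1} e^{-n/X}` (`= L(smoothed f X, 1)`).
With Zhang's `φ(w) = (ζ(2w) ∏_{p∣D}(1 + p^{-w}))^{-1}` (`phi`; so that
`∑ ν(n)² n^{-w} = ζ(w)² L(w,χ)² φ(w)`, `DivisorSumCharSq.LSeries_divisorSumChar_sq_eq_div_LFunction`)
and `g(z) := L(1+z, χ)² φ(1+z)` (`gFun`, holomorphic on `re z > -1/2`), we prove, for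
`0 < X₁`, `0 < X₂`:

  `W_{ν²}(X₂) − W_{ν²}(X₁) = g(0) · (W_τ(X₂) − W_τ(X₁)) + g′(0) · (log X₂ − log X₁)
      + (1/2π) ∫ N(−1/4 + iy) / (−1/4 + iy) dy`            (`explicit_formula`)

where `N(z) = ζ₁(1+z)² Γ(z+1) ε(z) · (g(z) − g(0))/z` (`numer`; `ζ₁(w) = (w−1)ζ(w)` Mathlib's
`riemannZeta₁`, `ε(z) = (X₂^z − X₁^z)/z`, both extended holomorphically through `z = 0`), so that
away from `z = 0`, `N(z)/z = ζ(1+z)² Γ(z) (X₂^z − X₁^z) (g(z) − g(0))` (`numer_div_eq`). This is the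
Mellin/contour skeleton of Y. Zhang, arXiv:2211.02515, §3, proof of Lemma 3.1
("`∑_n ν(n)²/n (exp(−n/P²) − exp(−n/D⁴)) = (1/2πi) ∫_{(1)} F(1+s) Γ(s) (P^{2s} − D^{4s}) ds`
… moved to the line `σ = −1/2` …"): Mellin on the line `re z = 2`
(the tree's `ZetaM4.integral_GammaK_cpow_LSeries_two`), the split
`F(1+z) = ζ(1+z)² g(z) = g(0) ζ(1+z)² + ζ(1+z)² (g(z) − g(0))` which leaves only a SIMPLE pole at
`z = 0` in the second piece (the first piece is `g(0)` times the same smoothed sum for `τ`), and the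
shift of the second piece to `re z = −1/4` by the tree's strip residue theorem
`HuxleyZeroDetection.integral_vertical_sub_eq_of_pole` (growth: `ζ₁`, `Γ`, `L(·,χ)` polynomial /
exponentially small on vertical lines — `EulerMaclaurinZeta`, `ZetaM4.norm_Gamma_strip_le`,
`DirichletAbel.norm_LFunction_le`). The BOUNDS that turn this identity into Zhang's Lemma 3.1 under
his hypothesis (A) are not in this file. Only definitions of that manuscript (under audit in this
tree) are used; no statement about its theorems is implied.

## References

* Y. Zhang, *Discrete mean estimates and the Landau–Siegel zero*, arXiv:2211.02515 (2022), §3,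
  proof of Lemma 3.1. [cite: Zhang2022LandauSiegel, §3, proof of Lemma 3.1]
* E. C. Titchmarsh, *The Theory of the Riemann Zeta-Function*, 2nd ed. (1986), §1.2 (1.2.10).
-/

noncomputable section

open Complex Filter Topology Set MeasureTheory Real
open scoped LSeries.notation

namespace Literature.NumberTheory.LFunctions.DivisorSumCharSq

open Literature.NumberTheory.LFunctions.ZetaM4 (dCoeff dCoeff_apply norm_dCoeff_le_one_mul
  LSeries_dCoeff integral_GammaK_cpow_LSeries_two smoothedPow smoothedPow_zero CΓ CΓ_pos
  norm_Gamma_strip_le pow_mul_exp_le integrable_pow_mul_exp exists_pow_mul_exp_le)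
open Literature.NumberTheory.LFunctions.HuxleyZeroDetection (smoothed integral_vertical_sub_eq_of_pole)

/-! ### Zhang's `φ(w) = (ζ(2w) ∏_{p ∣ N}(1 + p^{-w}))^{-1}` on `re w > 1/2` -/

section Phi

variable {N : ℕ}

/-- `φ(w) = (ζ(2w) ∏_{p ∣ N}(1 + p^{-w}))^{-1}`, the function `φ` of Zhang 2022, §3, in closed form
(`∑ ν(n)² n^{-w} = ζ(w)² L(w,χ)² φ(w)` for `re w > 1`, `χ` quadratic mod `N`).
[cite: Zhang2022LandauSiegel, §3 (3.3)] -/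
def phi (N : ℕ) (w : ℂ) : ℂ := (riemannZeta (2 * w) * ∏ p ∈ N.primeFactors, (1 + (p : ℂ) ^ (-w)))⁻¹

/-- Unfolding lemma for `phi`. [cite: Zhang2022LandauSiegel, §3 (3.3)] -/
theorem phi_def (N : ℕ) (w : ℂ) :
    phi N w = (riemannZeta (2 * w) * ∏ p ∈ N.primeFactors, (1 + (p : ℂ) ^ (-w)))⁻¹ := rfl

/-- `∏_{p ∣ D}(1 + p^{-w}) ≠ 0` for `re w > 0` (each `‖p^{-w}‖ = p^{-re w} < 1`; cf. the tree's
`EulerProductMeanSquare.norm_prime_cpow_neg_lt_one`). [folklore] -/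
theorem prod_one_add_cpow_ne_zero {w : ℂ} (hw : 0 < w.re) :
    ∏ p ∈ N.primeFactors, (1 + (p : ℂ) ^ (-w)) ≠ 0 := by
  refine Finset.prod_ne_zero_iff.2 fun p hp => ?_
  have hp' := Nat.prime_of_mem_primeFactors hp
  have h1 : ‖(p : ℂ) ^ (-w)‖ < 1 := by
    rw [norm_natCast_cpow_of_pos hp'.pos, neg_re]
    exact Real.rpow_lt_one_of_one_lt_of_neg (by exact_mod_cast hp'.one_lt) (by linarith)
  intro h
  have : (p : ℂ) ^ (-w) = -1 := by linear_combination h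
  rw [this, norm_neg, norm_one] at h1
  exact lt_irrefl _ h1

/-- `ζ(2w) ∏_{p ∣ D}(1 + p^{-w}) ≠ 0` for `re w > 1/2`. [folklore] -/
theorem zeta_two_mul_mul_prod_ne_zero' {w : ℂ} (hw : 1 / 2 < w.re) :
    riemannZeta (2 * w) * ∏ p ∈ N.primeFactors, (1 + (p : ℂ) ^ (-w)) ≠ 0 := by
  refine mul_ne_zero (riemannZeta_ne_zero_of_one_lt_re ?_) (prod_one_add_cpow_ne_zero (by linarith))
  simp only [mul_re, re_ofNat, im_ofNat, zero_mul, sub_zero]; linarith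

/-- `w ↦ ζ(2w) ∏_{p ∣ D}(1 + p^{-w})` is differentiable at every `w` with `re w > 1/2`. [folklore] -/
theorem differentiableAt_zeta_two_mul_mul_prod {w : ℂ} (hw : 1 / 2 < w.re) :
    DifferentiableAt ℂ
      (fun w : ℂ => riemannZeta (2 * w) * ∏ p ∈ N.primeFactors, (1 + (p : ℂ) ^ (-w))) w := by
  refine DifferentiableAt.mul ?_ ?_
  · have h2 : (2 : ℂ) * w ≠ 1 := by
      intro h
      have := congrArg Complex.re h
      simp only [mul_re, re_ofNat, im_ofNat, zero_mul, sub_zero, one_re] at this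
      linarith
    exact (differentiableAt_riemannZeta h2).comp w ((differentiableAt_id.const_mul _))
  · refine DifferentiableAt.fun_finsetProd fun p hp => ?_
    have hp0 : (p : ℂ) ≠ 0 := by exact_mod_cast (Nat.prime_of_mem_primeFactors hp).ne_zero
    have hneg : DifferentiableAt ℂ (fun w : ℂ => -w) w := differentiableAt_id.neg
    exact (differentiableAt_const _).add (hneg.const_cpow (Or.inl hp0))

/-- `φ` is differentiable at every `w` with `re w > 1/2`. [cite: Zhang2022LandauSiegel, §3 (3.3)] -/
theorem differentiableAt_phi (N : ℕ) {w : ℂ} (hw : 1 / 2 < w.re) :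
    DifferentiableAt ℂ (phi N) w := by
  unfold phi
  exact (differentiableAt_zeta_two_mul_mul_prod hw).inv (zeta_two_mul_mul_prod_ne_zero' hw)

end Phi

/-! ### `g(z) = L(1+z,χ)² φ(1+z)` -/

variable {D : ℕ} [NeZero D] (χ : DirichletCharacter ℂ D)

/-- `g(z) = L(1+z, χ)² φ(1+z)`. [cite: Zhang2022LandauSiegel, §3, proof of Lemma 3.1] -/
def gFun (z : ℂ) : ℂ := χ.LFunction (1 + z) ^ 2 * phi D (1 + z)

/-- Unfolding lemma for `gFun`. [cite: Zhang2022LandauSiegel, §3, proof of Lemma 3.1] -/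
theorem gFun_def (z : ℂ) : gFun χ z = χ.LFunction (1 + z) ^ 2 * phi D (1 + z) := rfl

/-- `∑ ν(n)² n^{-(1+z)} = ζ(1+z)² g(z)` for `re z > 0`. [cite: Zhang2022LandauSiegel, §3 (3.3)] -/
theorem LSeries_divisorSumChar_sq_one_add (hχ : χ ^ 2 = 1) {z : ℂ} (hz : 0 < z.re) :
    L (fun n => divisorSumChar χ n ^ 2) (1 + z) = riemannZeta (1 + z) ^ 2 * gFun χ z := by
  have h1 : 1 < (1 + z).re := by simp; linarith
  rw [LSeries_divisorSumChar_sq_eq_div_LFunction χ hχ h1, gFun, phi, div_eq_mul_inv]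
  ring

/-- `g` is differentiable on the open half-plane `re z > −1/2` (`χ ≠ 1`, so `L(·,χ)` is entire).
[cite: Zhang2022LandauSiegel, §3 (3.3)] -/
theorem differentiableOn_gFun (hχ1 : χ ≠ 1) :
    DifferentiableOn ℂ (gFun χ) {z : ℂ | -(1 / 2) < z.re} := by
  intro z hz
  refine DifferentiableAt.differentiableWithinAt ?_
  unfold gFun
  have h1 : DifferentiableAt ℂ (fun z : ℂ => (1 : ℂ) + z) z := differentiableAt_id.const_add _
  refine (((DirichletCharacter.differentiable_LFunction hχ1).differentiableAt.comp z h1).pow 2).mul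
    ?_
  have hw : 1 / 2 < ((1 : ℂ) + z).re := by
    simp only [add_re, one_re]; simp only [mem_setOf_eq] at hz; linarith
  exact (differentiableAt_phi D hw).comp z h1

/-! ### The kernel pieces `ε(z) = (X₂^z − X₁^z)/z` and the numerator `N` -/

variable (X₁ X₂ : ℝ)

/-- `ε(z) = (X₂^z − X₁^z)/z`, extended by `ε(0) = log X₂ − log X₁` (Mathlib's `dslope` at `0`).
[folklore] -/
def eps : ℂ → ℂ := dslope (fun z : ℂ => (X₂ : ℂ) ^ z - (X₁ : ℂ) ^ z) 0

/-- Off `0`, `ε(z) = (X₂^z − X₁^z)/z`. [folklore] -/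
theorem eps_of_ne_zero {z : ℂ} (hz : z ≠ 0) :
    eps X₁ X₂ z = ((X₂ : ℂ) ^ z - (X₁ : ℂ) ^ z) / z := by
  rw [eps, dslope_of_ne _ hz, slope_def_field]
  simp

variable {X₁ X₂}

/-- `ε(0) = log X₂ − log X₁`. [folklore] -/
theorem eps_zero (hX₁ : 0 < X₁) (hX₂ : 0 < X₂) :
    eps X₁ X₂ 0 = Real.log X₂ - Real.log X₁ := by
  rw [eps, dslope_same]
  have h2 : HasDerivAt (fun z : ℂ => (X₂ : ℂ) ^ z) ((X₂ : ℂ) ^ (0 : ℂ) * Complex.log X₂) 0 :=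
    (hasDerivAt_id (0 : ℂ)).const_cpow (Or.inl (ofReal_ne_zero.2 hX₂.ne')) |>.congr_deriv (by simp)
  have h1 : HasDerivAt (fun z : ℂ => (X₁ : ℂ) ^ z) ((X₁ : ℂ) ^ (0 : ℂ) * Complex.log X₁) 0 :=
    (hasDerivAt_id (0 : ℂ)).const_cpow (Or.inl (ofReal_ne_zero.2 hX₁.ne')) |>.congr_deriv (by simp)
  have h : HasDerivAt (fun z : ℂ => (X₂ : ℂ) ^ z - (X₁ : ℂ) ^ z)
      ((X₂ : ℂ) ^ (0 : ℂ) * Complex.log X₂ - (X₁ : ℂ) ^ (0 : ℂ) * Complex.log X₁) 0 := h2.sub h1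
  rw [h.deriv, cpow_zero, cpow_zero, one_mul, one_mul, ofReal_log hX₂.le, ofReal_log hX₁.le]

/-- `ε` is entire. [folklore] -/
theorem differentiable_eps (hX₁ : 0 < X₁) (hX₂ : 0 < X₂) : Differentiable ℂ (eps X₁ X₂) := by
  have hd : Differentiable ℂ (fun z : ℂ => (X₂ : ℂ) ^ z - (X₁ : ℂ) ^ z) :=
    (differentiable_id.const_cpow (Or.inl (ofReal_ne_zero.2 hX₂.ne'))).sub
      (differentiable_id.const_cpow (Or.inl (ofReal_ne_zero.2 hX₁.ne')))
  rw [← differentiableOn_univ, eps, Complex.differentiableOn_dslope (univ_mem : univ ∈ 𝓝 (0:ℂ))]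
  exact hd.differentiableOn

variable (X₁ X₂)

/-- The numerator `N(z) = ζ₁(1+z)² Γ(z+1) ε(z) · (g(z) − g(0))/z` (the last factor is Mathlib's
`dslope g 0`), holomorphic on `re z > −1/2`; the shifted integrand is `N(z)/z`.
[cite: Zhang2022LandauSiegel, §3, proof of Lemma 3.1] -/
def numer (z : ℂ) : ℂ :=
  riemannZeta₁ (1 + z) ^ 2 * Complex.Gamma (z + 1) * eps X₁ X₂ z * dslope (gFun χ) 0 z

variable {X₁ X₂}

/-- `N(0) = (log X₂ − log X₁) · g′(0)`. [cite: Zhang2022LandauSiegel, §3, proof of Lemma 3.1] -/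
theorem numer_zero (hX₁ : 0 < X₁) (hX₂ : 0 < X₂) :
    numer χ X₁ X₂ 0 = (Real.log X₂ - Real.log X₁) * deriv (gFun χ) 0 := by
  rw [numer, add_zero, riemannZeta₁_one, zero_add, Complex.Gamma_one, eps_zero hX₁ hX₂, dslope_same]
  ring

/-- Off `z = 0` (and off the poles), `N(z)/z = ζ(1+z)² Γ(z) (X₂^z − X₁^z) (g(z) − g(0))`.
[cite: Zhang2022LandauSiegel, §3, proof of Lemma 3.1] -/
theorem numer_div_eq {z : ℂ} (hz : z ≠ 0) (hz' : ∀ m : ℕ, z ≠ -(m : ℂ)) :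
    numer χ X₁ X₂ z / z = riemannZeta (1 + z) ^ 2 * Complex.Gamma z *
      (((X₂ : ℂ) ^ z - (X₁ : ℂ) ^ z) * (gFun χ z - gFun χ 0)) := by
  have h1 : (1 : ℂ) + z ≠ 1 := by intro h; exact hz (by linear_combination h)
  rw [numer, LFunctions.riemannZeta₁_eq_mul h1, Complex.Gamma_add_one _ hz, eps_of_ne_zero _ _ hz,
    dslope_of_ne _ hz, slope_def_field, sub_zero, add_sub_cancel_left]
  have := hz' 0
  field_simp

/-- `N` is differentiable on the open half-plane `re z > −1/2`.
[cite: Zhang2022LandauSiegel, §3, proof of Lemma 3.1] -/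
theorem differentiableOn_numer (hχ1 : χ ≠ 1) (hX₁ : 0 < X₁) (hX₂ : 0 < X₂) :
    DifferentiableOn ℂ (numer χ X₁ X₂) {z : ℂ | -(1 / 2) < z.re} := by
  have hU : {z : ℂ | -(1 / 2) < z.re} ∈ 𝓝 (0 : ℂ) :=
    (isOpen_lt continuous_const Complex.continuous_re).mem_nhds (by simp)
  have hq : DifferentiableOn ℂ (dslope (gFun χ) 0) {z : ℂ | -(1 / 2) < z.re} :=
    (Complex.differentiableOn_dslope hU).2 (differentiableOn_gFun χ hχ1)
  intro z hz
  have hz' : -(1 / 2) < z.re := hz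
  refine DifferentiableWithinAt.mul ?_ (hq z hz)
  refine DifferentiableAt.differentiableWithinAt ?_
  refine DifferentiableAt.mul (DifferentiableAt.mul ?_ ?_) ((differentiable_eps hX₁ hX₂) z)
  · exact ((differentiable_riemannZeta₁.comp
      ((differentiable_const (1 : ℂ)).add differentiable_id)) z).pow 2
  · refine (Complex.differentiableAt_Gamma _ fun m hm => ?_).comp z (differentiableAt_id.add_const 1)
    have := congrArg Complex.re hm
    simp at this
    have h0 : (0 : ℝ) ≤ m := Nat.cast_nonneg m
    linarith

/-! ### The smoothed sums `W_f(Y) = ∑ f(n) n^{-1} e^{-n/Y}` and Mellin on the line `re z = 2` -/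

/-- `W_f(Y) = ∑_{n ≥ 1} f(n) n^{-1} e^{-n/Y}`, as the value at `1` of the `L`-series of the smoothed
coefficients `f(n) e^{-n/Y}`. [folklore] -/
def W (f : ℕ → ℂ) (Y : ℝ) : ℂ := L (smoothed f Y) 1

/-- `W_f(Y) = ∑' n, f(n) e^{-n/Y} / n`. [folklore] -/
theorem W_eq_tsum (f : ℕ → ℂ) (Y : ℝ) :
    W f Y = ∑' n : ℕ, f n * (Real.exp (-(n / Y)) : ℂ) / n := by
  rw [W, LSeries]
  refine tsum_congr fun n => ?_
  rcases eq_or_ne n 0 with rfl | hn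
  · simp [LSeries.term]
  · rw [LSeries.term_of_ne_zero hn, cpow_one, smoothed]

/-- The constant `∑_{n ≥ 1} ‖f(n)‖ n^{-3}` bounding `‖L(f, 3 + iy)‖`. [folklore] -/
theorem norm_LSeries_three_add_le {f : ℕ → ℂ} {C : ℝ} (hf : ∀ n, ‖f n‖ ≤ C * n) (y : ℝ) :
    ‖L f (1 + (2 + y * I))‖ ≤ ∑' n : ℕ, ‖LSeries.term f 3 n‖ := by
  have hs : (2 : ℝ) < (1 + (2 + y * I) : ℂ).re := by norm_num
  have hsum : LSeriesSummable f (1 + (2 + y * I)) :=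
    LSeriesSummable_of_le_const_mul_rpow hs
      ⟨C, fun n _ => by rw [show (2 : ℝ) - 1 = 1 by norm_num, Real.rpow_one]; exact hf n⟩
  have heq : ∀ n, ‖LSeries.term f (1 + (2 + y * I)) n‖ = ‖LSeries.term f 3 n‖ := by
    intro n
    rw [LSeries.norm_term_eq, LSeries.norm_term_eq]
    have h3 : ((1 + (2 + y * I) : ℂ)).re = (3 : ℂ).re := by simp; norm_num
    rw [h3]
  calc ‖L f (1 + (2 + y * I))‖ ≤ ∑' n, ‖LSeries.term f (1 + (2 + y * I)) n‖ :=
        norm_tsum_le_tsum_norm hsum.norm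
    _ = ∑' n, ‖LSeries.term f 3 n‖ := tsum_congr heq

/-- `y ↦ L(f, 3 + iy)` is continuous (for `‖f(n)‖ ≤ C n`). [folklore] -/
theorem continuous_LSeries_three_add {f : ℕ → ℂ} {C : ℝ} (hf : ∀ n, ‖f n‖ ≤ C * n) :
    Continuous fun y : ℝ => L f (1 + (2 + y * I)) := by
  have hsum : LSeriesSummable f (5 / 2 : ℂ) :=
    LSeriesSummable_of_le_const_mul_rpow (x := 2) (by norm_num)
      ⟨C, fun n _ => by rw [show (2 : ℝ) - 1 = 1 by norm_num, Real.rpow_one]; exact hf n⟩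
  have habs : LSeries.abscissaOfAbsConv f < (3 : ℝ) := by
    refine lt_of_le_of_lt hsum.abscissaOfAbsConv_le ?_
    have : ((5 / 2 : ℂ)).re = (5 / 2 : ℝ) := by norm_num
    rw [this]
    exact_mod_cast (by norm_num : (5 / 2 : ℝ) < 3)
  have hline : Continuous fun y : ℝ => (1 + (2 + y * I) : ℂ) := by fun_prop
  refine (LSeries_differentiableOn f).continuousOn.comp_continuous hline fun y => ?_
  simp only [mem_setOf_eq]
  have h3 : ((1 + (2 + y * I) : ℂ)).re = (3 : ℝ) := by simp; norm_num
  rw [h3]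
  exact habs

/-- Integrability of `y ↦ Γ(2+iy) Y^{2+iy} L(f, 3+iy)` (for `‖f(n)‖ ≤ C n`, `Y > 0`). [folklore] -/
theorem integrable_Gamma_cpow_LSeries {f : ℕ → ℂ} {C : ℝ} (hf : ∀ n, ‖f n‖ ≤ C * n) {Y : ℝ}
    (hY : 0 < Y) :
    Integrable fun y : ℝ => Complex.Gamma (2 + y * I) * (Y : ℂ) ^ (2 + y * I : ℂ) *
      L f (1 + (2 + y * I)) := by
  set B : ℝ := ∑' n : ℕ, ‖LSeries.term f 3 n‖ with hB
  have hΓ : Integrable fun y : ℝ => Complex.Gamma (2 + y * I) := by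
    simpa using ZetaM4.integrable_Gamma_two_add_line (k := 0) (by norm_num)
  have hΓc : Continuous fun y : ℝ => Complex.Gamma (2 + y * I) := by
    simpa using ZetaM4.continuous_Gamma_line_pos (c := 2) two_pos
  have hc : Continuous fun y : ℝ => Complex.Gamma (2 + y * I) * (Y : ℂ) ^ (2 + y * I : ℂ) *
      L f (1 + (2 + y * I)) := by
    refine (hΓc.mul ?_).mul (continuous_LSeries_three_add hf)
    exact Continuous.const_cpow (by fun_prop) (Or.inl (ofReal_ne_zero.2 hY.ne'))
  refine ((hΓ.norm.mul_const (Y ^ (2 : ℝ) * B))).mono' hc.aestronglyMeasurable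
    (Eventually.of_forall fun y => ?_)
  rw [norm_mul, norm_mul, Complex.norm_cpow_eq_rpow_re_of_pos hY]
  have hre : (2 + y * I : ℂ).re = 2 := by simp
  rw [hre, mul_assoc]
  gcongr
  exact norm_LSeries_three_add_le hf y

/-- **Mellin on `re z = 2`** (the tree's `ZetaM4.integral_GammaK_cpow_LSeries_two` with `k = 0`):
`∫ Γ(2+iy) Y^{2+iy} L(f, 3+iy) dy = 2π W_f(Y)`. [folklore] -/
theorem integral_Gamma_cpow_LSeries_eq {f : ℕ → ℂ} {C : ℝ} (hf : ∀ n, ‖f n‖ ≤ C * n) {Y : ℝ}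
    (hY : 0 < Y) :
    ∫ y : ℝ, Complex.Gamma (2 + y * I) * (Y : ℂ) ^ (2 + y * I : ℂ) * L f (1 + (2 + y * I)) =
      2 * π * W f Y := by
  have h := integral_GammaK_cpow_LSeries_two (k := 0) (by norm_num) hf hY (s := 1) (by simp)
  simp only [Nat.cast_zero, add_zero, smoothedPow_zero] at h
  rw [h, W]

omit [NeZero D] in
/-- `‖ν(n)²‖ ≤ C n` for some `C` (from the divisor bound `d(n) ≤ C₀ n^{1/2}`). [folklore] -/
theorem exists_norm_divisorSumChar_sq_le :
    ∃ C : ℝ, ∀ n : ℕ, ‖divisorSumChar χ n ^ 2‖ ≤ C * n := by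
  obtain ⟨C₀, hC₀, h⟩ := Sieve.exists_card_divisors_le_mul_rpow (by norm_num : (0 : ℝ) < 1 / 2)
  refine ⟨C₀ ^ 2, fun n => ?_⟩
  rcases eq_or_ne n 0 with rfl | hn
  · simp
  rw [norm_pow]
  have h1 := (norm_divisorSumChar_le χ n).trans (h n hn)
  have h0 : 0 ≤ ‖divisorSumChar χ n‖ := norm_nonneg _
  calc ‖divisorSumChar χ n‖ ^ 2 ≤ (C₀ * (n : ℝ) ^ (1 / 2 : ℝ)) ^ 2 := pow_le_pow_left₀ h0 h1 2
    _ = C₀ ^ 2 * ((n : ℝ) ^ (1 / 2 : ℝ)) ^ 2 := by ring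
    _ = C₀ ^ 2 * n := by
        rw [← Real.rpow_natCast ((n : ℝ) ^ (1 / 2 : ℝ)) 2, ← Real.rpow_mul (Nat.cast_nonneg n)]
        norm_num

/-- The integrand on `re z = 2`: for `z = 2 + iy`,
`N(z)/z = Γ(z) X₂^z L(ν²,1+z) − Γ(z) X₁^z L(ν²,1+z) − g(0)(Γ(z) X₂^z L(d,1+z) − Γ(z) X₁^z L(d,1+z))`.
[cite: Zhang2022LandauSiegel, §3, proof of Lemma 3.1] -/
theorem numer_div_line_two (hχ : χ ^ 2 = 1) (y : ℝ) :
    numer χ X₁ X₂ (2 + y * I) / (2 + y * I - 0) =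
      (Complex.Gamma (2 + y * I) * (X₂ : ℂ) ^ (2 + y * I : ℂ) *
          L (fun n => divisorSumChar χ n ^ 2) (1 + (2 + y * I)) -
        Complex.Gamma (2 + y * I) * (X₁ : ℂ) ^ (2 + y * I : ℂ) *
          L (fun n => divisorSumChar χ n ^ 2) (1 + (2 + y * I))) -
      gFun χ 0 * (Complex.Gamma (2 + y * I) * (X₂ : ℂ) ^ (2 + y * I : ℂ) *
          L dCoeff (1 + (2 + y * I)) -
        Complex.Gamma (2 + y * I) * (X₁ : ℂ) ^ (2 + y * I : ℂ) * L dCoeff (1 + (2 + y * I))) := by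
  have hz : (2 + y * I : ℂ) ≠ 0 := by
    intro h; have := congrArg Complex.re h; simp at this
  have hz' : ∀ m : ℕ, (2 + y * I : ℂ) ≠ -(m : ℂ) := by
    intro m h
    have := congrArg Complex.re h
    simp only [add_re, re_ofNat, mul_re, ofReal_re, I_re, mul_zero, ofReal_im, I_im, mul_one,
      sub_self, add_zero, neg_re, natCast_re] at this
    linarith [(Nat.cast_nonneg m : (0:ℝ) ≤ m)]
  have hre : 0 < (2 + y * I : ℂ).re := by simp
  have h3 : 1 < (1 + (2 + y * I) : ℂ).re := by norm_num
  rw [sub_zero, numer_div_eq χ hz hz', LSeries_divisorSumChar_sq_one_add χ hχ hre, LSeries_dCoeff h3]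
  ring

/-- **The line `re z = 2`**: `∫ N(2+iy)/(2+iy) dy
= 2π [ (W_{ν²}(X₂) − W_{ν²}(X₁)) − g(0) (W_d(X₂) − W_d(X₁)) ]`, and the integrand is integrable.
[cite: Zhang2022LandauSiegel, §3, proof of Lemma 3.1] -/
theorem integral_numer_line_two (hχ : χ ^ 2 = 1) (hX₁ : 0 < X₁) (hX₂ : 0 < X₂) :
    Integrable (fun y : ℝ => numer χ X₁ X₂ (2 + y * I) / (2 + y * I - 0)) ∧
    ∫ y : ℝ, numer χ X₁ X₂ (2 + y * I) / (2 + y * I - 0) =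
      2 * π * ((W (fun n => divisorSumChar χ n ^ 2) X₂ - W (fun n => divisorSumChar χ n ^ 2) X₁) -
        gFun χ 0 * (W dCoeff X₂ - W dCoeff X₁)) := by
  obtain ⟨C, hC⟩ := exists_norm_divisorSumChar_sq_le χ
  have hd : ∀ n, ‖dCoeff n‖ ≤ 1 * n := norm_dCoeff_le_one_mul
  have I₁ := integrable_Gamma_cpow_LSeries hC hX₂
  have I₂ := integrable_Gamma_cpow_LSeries hC hX₁
  have I₃ := integrable_Gamma_cpow_LSeries hd hX₂
  have I₄ := integrable_Gamma_cpow_LSeries hd hX₁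
  have hfun : (fun y : ℝ => numer χ X₁ X₂ (2 + y * I) / (2 + y * I - 0)) = fun y : ℝ =>
      (Complex.Gamma (2 + y * I) * (X₂ : ℂ) ^ (2 + y * I : ℂ) *
          L (fun n => divisorSumChar χ n ^ 2) (1 + (2 + y * I)) -
        Complex.Gamma (2 + y * I) * (X₁ : ℂ) ^ (2 + y * I : ℂ) *
          L (fun n => divisorSumChar χ n ^ 2) (1 + (2 + y * I))) -
      gFun χ 0 * (Complex.Gamma (2 + y * I) * (X₂ : ℂ) ^ (2 + y * I : ℂ) *
          L dCoeff (1 + (2 + y * I)) -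
        Complex.Gamma (2 + y * I) * (X₁ : ℂ) ^ (2 + y * I : ℂ) * L dCoeff (1 + (2 + y * I))) :=
    funext fun y => numer_div_line_two χ hχ y
  rw [hfun]
  have I12 : Integrable fun y : ℝ =>
      Complex.Gamma (2 + y * I) * (X₂ : ℂ) ^ (2 + y * I : ℂ) *
          L (fun n => divisorSumChar χ n ^ 2) (1 + (2 + y * I)) -
        Complex.Gamma (2 + y * I) * (X₁ : ℂ) ^ (2 + y * I : ℂ) *
          L (fun n => divisorSumChar χ n ^ 2) (1 + (2 + y * I)) := I₁.sub I₂
  have I34 : Integrable fun y : ℝ =>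
      Complex.Gamma (2 + y * I) * (X₂ : ℂ) ^ (2 + y * I : ℂ) * L dCoeff (1 + (2 + y * I)) -
        Complex.Gamma (2 + y * I) * (X₁ : ℂ) ^ (2 + y * I : ℂ) * L dCoeff (1 + (2 + y * I)) :=
    I₃.sub I₄
  have I34' : Integrable fun y : ℝ => gFun χ 0 *
      (Complex.Gamma (2 + y * I) * (X₂ : ℂ) ^ (2 + y * I : ℂ) * L dCoeff (1 + (2 + y * I)) -
        Complex.Gamma (2 + y * I) * (X₁ : ℂ) ^ (2 + y * I : ℂ) * L dCoeff (1 + (2 + y * I))) :=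
    I34.const_mul _
  refine ⟨I12.sub I34', ?_⟩
  rw [integral_sub I12 I34', integral_sub I₁ I₂, integral_const_mul, integral_sub I₃ I₄,
    integral_Gamma_cpow_LSeries_eq hC hX₂, integral_Gamma_cpow_LSeries_eq hC hX₁,
    integral_Gamma_cpow_LSeries_eq hd hX₂, integral_Gamma_cpow_LSeries_eq hd hX₁]
  ring

/-! ### Bounds in the closed strip `−1/4 ≤ re z ≤ 2` -/

/-- `Z = ∑_{n ≥ 1} n^{-7/4}`, the constant in the bound for `L(1+z, χ)` on `re z ≥ −1/4`.
[folklore] -/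
def Zconst : ℝ := ∑' n : ℕ, ((n + 1 : ℕ) : ℝ) ^ (-(3 / 4 : ℝ) - 1)

omit [NeZero D] in
/-- `Z ≥ 0`. [folklore] -/
theorem Zconst_nonneg : 0 ≤ Zconst := tsum_nonneg fun n => by positivity

/-- For `χ ≠ 1` and `re z ≥ −1/4`: `‖L(1+z, χ)‖ ≤ D ‖1+z‖ Z` (Abel summation, the tree's
`DirichletAbel.norm_LFunction_le`). [folklore] -/
theorem norm_LFunction_one_add_le (hχ1 : χ ≠ 1) {z : ℂ} (h1 : -(1 / 4) ≤ z.re) :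
    ‖χ.LFunction (1 + z)‖ ≤ D * ‖1 + z‖ * Zconst := by
  have hs : 0 < (1 + z : ℂ).re := by simp; linarith
  refine (DirichletAbel.norm_LFunction_le χ hχ1 hs).trans ?_
  have hZ : ∑' n : ℕ, ((n + 1 : ℕ) : ℝ) ^ (-(1 + z : ℂ).re - 1) ≤ Zconst := by
    refine Summable.tsum_le_tsum (fun n => ?_) (DirichletAbel.summable_rpow_neg hs)
      (DirichletAbel.summable_rpow_neg (by norm_num))
    refine Real.rpow_le_rpow_of_exponent_le (by exact_mod_cast Nat.le_add_left 1 n) ?_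
    simp only [add_re, one_re] at *
    linarith
  have h0 : 0 ≤ (D : ℝ) * ‖1 + z‖ := by positivity
  exact mul_le_mul_of_nonneg_left hZ h0

/-- `0 < 1 − 2^{-3/4}`. [folklore] -/
theorem one_sub_two_rpow_pos : 0 < 1 - (2 : ℝ) ^ (-(3 / 4 : ℝ)) := by
  have : (2 : ℝ) ^ (-(3 / 4 : ℝ)) < 1 :=
    Real.rpow_lt_one_of_one_lt_of_neg (by norm_num) (by norm_num)
  linarith

/-- The constant bounding `φ` on `re w ≥ 3/4`: `Φ_N = 3 (1 − 2^{-3/4})^{-ω(N)}`. [folklore] -/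
def phiBound (N : ℕ) : ℝ := 3 * ((1 - (2 : ℝ) ^ (-(3 / 4 : ℝ))) ^ N.primeFactors.card)⁻¹

omit [NeZero D] in
/-- `Φ_N > 0`. [folklore] -/
theorem phiBound_pos (N : ℕ) : 0 < phiBound N := by
  unfold phiBound
  have := one_sub_two_rpow_pos
  positivity

omit [NeZero D] in
/-- **`φ` is bounded on `re w ≥ 3/4`**: `‖φ(w)‖ ≤ Φ_N` (`‖ζ(2w)^{-1}‖ ≤ σ/(σ−1) ≤ 3` for
`σ = re 2w ≥ 3/2`, and `‖1 + p^{-w}‖ ≥ 1 − 2^{-3/4}`). [cite: Zhang2022LandauSiegel, §3 (3.3)] -/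
theorem norm_phi_le {N : ℕ} {w : ℂ} (hw : 3 / 4 ≤ w.re) : ‖phi N w‖ ≤ phiBound N := by
  have h2re : (2 * w : ℂ).re = 2 * w.re := by simp
  have h2 : 1 < (2 * w : ℂ).re := by rw [h2re]; linarith
  have hζ : ‖(riemannZeta (2 * w))⁻¹‖ ≤ 3 := by
    refine (ZetaClassicalRegion.norm_inv_riemannZeta_le_of_one_lt_re h2).trans ?_
    rw [div_le_iff₀ (by linarith), h2re]
    linarith
  set c₀ : ℝ := 1 - (2 : ℝ) ^ (-(3 / 4 : ℝ)) with hc₀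
  have hc₀pos : 0 < c₀ := one_sub_two_rpow_pos
  have hprod : c₀ ^ N.primeFactors.card ≤ ‖∏ p ∈ N.primeFactors, (1 + (p : ℂ) ^ (-w))‖ := by
    rw [norm_prod, ← Finset.prod_const]
    refine Finset.prod_le_prod (fun _ _ => hc₀pos.le) fun p hp => ?_
    have hp := Nat.prime_of_mem_primeFactors hp
    have hpw : ‖(p : ℂ) ^ (-w)‖ ≤ (2 : ℝ) ^ (-(3 / 4 : ℝ)) := by
      rw [norm_natCast_cpow_of_pos hp.pos, neg_re]
      calc (p : ℝ) ^ (-w.re) ≤ (2 : ℝ) ^ (-w.re) :=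
            Real.rpow_le_rpow_of_nonpos (by norm_num) (by exact_mod_cast hp.two_le)
              (by linarith)
        _ ≤ (2 : ℝ) ^ (-(3 / 4 : ℝ)) := Real.rpow_le_rpow_of_exponent_le (by norm_num) (by linarith)
    calc c₀ = 1 - (2 : ℝ) ^ (-(3 / 4 : ℝ)) := hc₀
      _ ≤ 1 - ‖(p : ℂ) ^ (-w)‖ := by linarith
      _ ≤ ‖1 + (p : ℂ) ^ (-w)‖ := by
          have := norm_sub_norm_le (1 : ℂ) (-(p : ℂ) ^ (-w))
          rw [norm_one, norm_neg, sub_neg_eq_add] at this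
          linarith
  rw [phi, mul_inv, norm_mul, phiBound]
  have hprodpos : 0 < c₀ ^ N.primeFactors.card := pow_pos hc₀pos _
  have hinv : ‖(∏ p ∈ N.primeFactors, (1 + (p : ℂ) ^ (-w)))⁻¹‖ ≤ (c₀ ^ N.primeFactors.card)⁻¹ := by
    rw [norm_inv]; exact inv_anti₀ hprodpos hprod
  exact mul_le_mul hζ hinv (norm_nonneg _) (by norm_num)

/-- **`g` in the strip**: for `χ ≠ 1`, `re z ≥ −1/4`, `‖g(z)‖ ≤ (D ‖1+z‖ Z)² Φ_D`.
[cite: Zhang2022LandauSiegel, §3 (3.3)] -/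
theorem norm_gFun_le (hχ1 : χ ≠ 1) {z : ℂ} (h1 : -(1 / 4) ≤ z.re) :
    ‖gFun χ z‖ ≤ (D * ‖1 + z‖ * Zconst) ^ 2 * phiBound D := by
  rw [gFun, norm_mul, norm_pow]
  have hw : 3 / 4 ≤ (1 + z : ℂ).re := by simp; linarith
  have hL := norm_LFunction_one_add_le χ hχ1 h1
  have hφ := norm_phi_le (N := D) hw
  have h0 : 0 ≤ ‖χ.LFunction (1 + z)‖ := norm_nonneg _
  gcongr

variable (X₁ X₂) in
/-- `M_X = X₂^{-1/4} + X₂² + X₁^{-1/4} + X₁²` bounds `X₂^x + X₁^x` for `−1/4 ≤ x ≤ 2`. [folklore] -/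
def MX : ℝ := X₂ ^ (-(1 / 4) : ℝ) + X₂ ^ (2 : ℝ) + (X₁ ^ (-(1 / 4) : ℝ) + X₁ ^ (2 : ℝ))

omit [NeZero D] in
/-- `X^x ≤ X^{-1/4} + X²` for `X > 0`, `−1/4 ≤ x ≤ 2`. [folklore] -/
theorem rpow_le_rpow_add {X x : ℝ} (hX : 0 < X) (h1 : -(1 / 4) ≤ x) (h2 : x ≤ 2) :
    X ^ x ≤ X ^ (-(1 / 4) : ℝ) + X ^ (2 : ℝ) := by
  rcases le_or_gt 1 X with hX1 | hX1
  · have := Real.rpow_le_rpow_of_exponent_le hX1 h2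
    linarith [Real.rpow_nonneg hX.le (-(1 / 4) : ℝ)]
  · have := Real.rpow_le_rpow_of_exponent_ge hX hX1.le h1
    linarith [Real.rpow_nonneg hX.le (2 : ℝ)]

/-- **`ε` in the strip**, away from `0`: `‖ε(z)‖ ≤ 4 M_X` for `−1/4 ≤ re z ≤ 2`, `‖z‖ ≥ 1/4`.
[folklore] -/
theorem norm_eps_le (hX₁ : 0 < X₁) (hX₂ : 0 < X₂) {z : ℂ} (h1 : -(1 / 4) ≤ z.re) (h2 : z.re ≤ 2)
    (hz : 1 / 4 ≤ ‖z‖) : ‖eps X₁ X₂ z‖ ≤ 4 * MX X₁ X₂ := by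
  have hz0 : z ≠ 0 := by
    intro h; rw [h, norm_zero] at hz; norm_num at hz
  rw [eps_of_ne_zero _ _ hz0, norm_div]
  have hnum : ‖(X₂ : ℂ) ^ z - (X₁ : ℂ) ^ z‖ ≤ MX X₁ X₂ := by
    refine (norm_sub_le _ _).trans ?_
    rw [Complex.norm_cpow_eq_rpow_re_of_pos hX₂, Complex.norm_cpow_eq_rpow_re_of_pos hX₁, MX]
    exact add_le_add (rpow_le_rpow_add hX₂ h1 h2) (rpow_le_rpow_add hX₁ h1 h2)
  have hM0 : 0 ≤ MX X₁ X₂ := by unfold MX; positivity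
  rw [div_le_iff₀ (by linarith)]
  nlinarith

variable (X₁ X₂) in
/-- The constant in the strip bound for `N`. [folklore] -/
def Knum (D : ℕ) : ℝ :=
  5 ^ 8 * CΓ * (4 * MX X₁ X₂) * (72 * ((D : ℝ) * Zconst) ^ 2 * phiBound D)

omit [NeZero D] in
/-- `K ≥ 0`. [folklore] -/
theorem Knum_nonneg (hX₁ : 0 < X₁) (hX₂ : 0 < X₂) (D : ℕ) : 0 ≤ Knum X₁ X₂ D := by
  unfold Knum MX
  have := CΓ_pos
  have := phiBound_pos D
  positivity

/-- **The numerator in the strip**: for `χ ≠ 1`, `−1/4 ≤ re z ≤ 2` and `‖z‖ ≥ 1/4`,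
`‖N(z)‖ ≤ K (1 + |im z|)¹³ e^{-π|im z|/2}`. [cite: Zhang2022LandauSiegel, §3, proof of Lemma 3.1] -/
theorem norm_numer_le (hχ1 : χ ≠ 1) (hX₁ : 0 < X₁) (hX₂ : 0 < X₂) {z : ℂ} (h1 : -(1 / 4) ≤ z.re)
    (h2 : z.re ≤ 2) (hz : 1 / 4 ≤ ‖z‖) :
    ‖numer χ X₁ X₂ z‖ ≤ Knum X₁ X₂ D * ((1 + |z.im|) ^ 13 * Real.exp (-(π * |z.im| / 2))) := by
  have hy0 := abs_nonneg z.im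
  have hzn : ‖z‖ ≤ 2 + |z.im| := by
    have := Complex.norm_le_abs_re_add_abs_im z
    have : |z.re| ≤ 2 := abs_le.2 ⟨by linarith, h2⟩
    linarith
  have h1z : ‖(1 : ℂ) + z‖ ≤ 3 * (1 + |z.im|) := by
    have := norm_add_le (1 : ℂ) z
    rw [norm_one] at this
    linarith
  -- ζ₁
  have hζ : ‖riemannZeta₁ (1 + z)‖ ≤ 5 ^ 4 * (1 + |z.im|) ^ 4 := by
    have h := BurnolVectors.norm_riemannZeta₁_le (s := 1 + z) (by simp; linarith)
    refine h.trans ?_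
    have : ‖(1 : ℂ) + z‖ + 2 ≤ 5 * (1 + |z.im|) := by linarith
    calc (‖(1 : ℂ) + z‖ + 2) ^ 4 ≤ (5 * (1 + |z.im|)) ^ 4 := by gcongr
      _ = 5 ^ 4 * (1 + |z.im|) ^ 4 := by ring
  -- Γ
  have hΓ : ‖Complex.Gamma (z + 1)‖ ≤ CΓ * (1 + |z.im|) ^ 3 * Real.exp (-(π * |z.im| / 2)) := by
    have := norm_Gamma_strip_le (x := z.re + 1) (by linarith) (by linarith) z.im
    have e : ((z.re + 1 : ℝ) : ℂ) + z.im * I = z + 1 := by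
      rw [show ((z.re + 1 : ℝ) : ℂ) = (z.re : ℂ) + 1 by push_cast; ring]
      conv_rhs => rw [← Complex.re_add_im z]
      ring
    rwa [e] at this
  -- ε
  have hε := norm_eps_le hX₁ hX₂ h1 h2 hz
  -- dslope g 0
  have hz0 : z ≠ 0 := by
    intro h; rw [h, norm_zero] at hz; norm_num at hz
  have hK : 0 ≤ ((D : ℝ) * Zconst) ^ 2 * phiBound D := by
    have := phiBound_pos D; positivity
  have hZ0 := Zconst_nonneg
  have hg : ‖gFun χ z‖ ≤ ((D : ℝ) * Zconst) ^ 2 * phiBound D * (9 * (1 + |z.im|) ^ 2) := by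
    refine (norm_gFun_le χ hχ1 h1).trans ?_
    have hφ := (phiBound_pos D).le
    calc ((D : ℝ) * ‖(1 : ℂ) + z‖ * Zconst) ^ 2 * phiBound D
        ≤ ((D : ℝ) * (3 * (1 + |z.im|)) * Zconst) ^ 2 * phiBound D := by gcongr
      _ = _ := by ring
  have hg0 : ‖gFun χ 0‖ ≤ ((D : ℝ) * Zconst) ^ 2 * phiBound D * (9 * (1 + |z.im|) ^ 2) := by
    refine (norm_gFun_le χ hχ1 (z := 0) (by simp)).trans ?_
    rw [add_zero, norm_one, mul_one]
    have h19 : (1 : ℝ) ≤ 9 * (1 + |z.im|) ^ 2 := by nlinarith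
    calc ((D : ℝ) * Zconst) ^ 2 * phiBound D = ((D : ℝ) * Zconst) ^ 2 * phiBound D * 1 := by ring
      _ ≤ _ := by gcongr
  have hq : ‖dslope (gFun χ) 0 z‖ ≤ 72 * ((D : ℝ) * Zconst) ^ 2 * phiBound D * (1 + |z.im|) ^ 2 := by
    rw [dslope_of_ne _ hz0, slope_def_field, sub_zero, norm_div, div_le_iff₀ (by linarith)]
    have := norm_sub_le (gFun χ z) (gFun χ 0)
    nlinarith [norm_nonneg (gFun χ z - gFun χ 0)]
  -- combine
  have hE := Real.exp_pos (-(π * |z.im| / 2))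
  have hMX : 0 ≤ MX X₁ X₂ := by unfold MX; positivity
  have hC := CΓ_pos
  have hφ0 := phiBound_pos D
  rw [numer, norm_mul, norm_mul, norm_mul, norm_pow]
  calc ‖riemannZeta₁ (1 + z)‖ ^ 2 * ‖Complex.Gamma (z + 1)‖ * ‖eps X₁ X₂ z‖ * ‖dslope (gFun χ) 0 z‖
      ≤ (5 ^ 4 * (1 + |z.im|) ^ 4) ^ 2 * (CΓ * (1 + |z.im|) ^ 3 * Real.exp (-(π * |z.im| / 2))) *
          (4 * MX X₁ X₂) * (72 * ((D : ℝ) * Zconst) ^ 2 * phiBound D * (1 + |z.im|) ^ 2) := by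
        gcongr
    _ = Knum X₁ X₂ D * ((1 + |z.im|) ^ 13 * Real.exp (-(π * |z.im| / 2))) := by
        rw [Knum]; ring

/-! ### The lines `re z = 2`, `re z = −1/4` and the horizontal decay -/

/-- `y ↦ N(c+iy)/(c+iy)` is continuous for `c > −1/2`, `c ≠ 0`. [folklore] -/
theorem continuous_numer_div_line (hχ1 : χ ≠ 1) (hX₁ : 0 < X₁) (hX₂ : 0 < X₂) {c : ℝ}
    (hc : -(1 / 2) < c) (hc0 : c ≠ 0) :
    Continuous fun y : ℝ => numer χ X₁ X₂ (c + y * I) / ((c : ℂ) + y * I - 0) := by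
  have hd := differentiableOn_numer χ hχ1 hX₁ hX₂
  have hline : Continuous fun y : ℝ => (c : ℂ) + y * I := by fun_prop
  refine (hd.continuousOn.comp_continuous hline fun y => by
    simp only [mem_setOf_eq, add_re, ofReal_re, mul_re, I_re, mul_zero, ofReal_im, I_im, mul_one,
      sub_self, add_zero]; exact hc).div
    (hline.congr fun y => by rw [sub_zero]) fun y h => hc0 ?_
  have := congrArg Complex.re h; simpa using this

/-- Integrability of `N(c+iy)/(c+iy)` on the lines `c = −1/4` and `c = 2`. [folklore] -/
theorem integrable_numer_div_line (hχ1 : χ ≠ 1) (hX₁ : 0 < X₁) (hX₂ : 0 < X₂) {c : ℝ}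
    (hc : c = -(1 / 4) ∨ c = 2) :
    Integrable fun y : ℝ => numer χ X₁ X₂ (c + y * I) / ((c : ℂ) + y * I - 0) := by
  have hc1 : -(1 / 4) ≤ c := by rcases hc with h | h <;> norm_num [h]
  have hc2 : c ≤ 2 := by rcases hc with h | h <;> norm_num [h]
  have hca : 1 / 4 ≤ |c| := by
    rcases hc with h | h <;> (rw [h]; norm_num [abs_of_neg, abs_of_pos])
  have hc0 : c ≠ 0 := by intro h; rw [h] at hca; norm_num at hca
  set K : ℝ := Knum X₁ X₂ D with hK
  have hK0 : 0 ≤ K := Knum_nonneg hX₁ hX₂ D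
  have hcont := continuous_numer_div_line χ hχ1 hX₁ hX₂ (c := c) (by linarith) hc0
  refine (((integrable_pow_mul_exp 13).const_mul (K * 4)).mono' hcont.aestronglyMeasurable
    (Eventually.of_forall fun y => ?_))
  rw [sub_zero, norm_div]
  have hw : 1 / 4 ≤ ‖((c : ℂ) + y * I)‖ := by
    have hre : (((c : ℂ) + y * I)).re = c := by simp
    have := abs_re_le_norm (((c : ℂ) + y * I))
    rw [hre] at this
    exact hca.trans this
  have him : (((c : ℂ) + y * I)).im = y := by simp
  have hb := norm_numer_le χ hχ1 hX₁ hX₂ (z := ((c : ℂ) + y * I)) (by simpa using hc1)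
    (by simpa using hc2) hw
  rw [← hK, him] at hb
  rw [div_le_iff₀ (by linarith)]
  calc ‖numer χ X₁ X₂ ((c : ℂ) + y * I)‖ ≤ K * ((1 + |y|) ^ 13 * Real.exp (-(π * |y| / 2))) := hb
    _ = K * 4 * ((1 + |y|) ^ 13 * Real.exp (-(π * |y| / 2))) * (1 / 4) := by ring
    _ ≤ K * 4 * ((1 + |y|) ^ 13 * Real.exp (-(π * |y| / 2))) * ‖((c : ℂ) + y * I)‖ := by
        gcongr

/-- Horizontal decay of `N(z)/z` in the strip `−1/4 ≤ re z ≤ 2`. [folklore] -/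
theorem numer_horizontal_decay (hχ1 : χ ≠ 1) (hX₁ : 0 < X₁) (hX₂ : 0 < X₂) (ε : ℝ) (hε : 0 < ε) :
    ∃ T₀ : ℝ, ∀ σ ∈ Icc (-(1 / 4) : ℝ) 2, ∀ T : ℝ, T₀ ≤ |T| →
      ‖numer χ X₁ X₂ (σ + T * I) / (σ + T * I - 0)‖ ≤ ε := by
  set K : ℝ := Knum X₁ X₂ D with hK
  have hK0 : 0 ≤ K := Knum_nonneg hX₁ hX₂ D
  obtain ⟨T₁, hT₁⟩ := exists_pow_mul_exp_le 13 hK0 hε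
  refine ⟨max T₁ 1, fun σ hσ T hT => ?_⟩
  have hTT : T₁ ≤ |T| := le_trans (le_max_left _ _) hT
  have hT1 : 1 ≤ |T| := le_trans (le_max_right _ _) hT
  set w : ℂ := (σ : ℂ) + T * I with hw
  have hwim : w.im = T := by simp [hw]
  have hwre : w.re = σ := by simp [hw]
  have hwn : 1 ≤ ‖w‖ := by
    have := abs_im_le_norm w; rw [hwim] at this; linarith
  have hb := norm_numer_le χ hχ1 hX₁ hX₂ (z := w) (by rw [hwre]; exact hσ.1) (by rw [hwre]; exact hσ.2)
    (by linarith)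
  rw [← hK, hwim] at hb
  rw [sub_zero, norm_div]
  calc ‖numer χ X₁ X₂ w‖ / ‖w‖ ≤ ‖numer χ X₁ X₂ w‖ := div_le_self (norm_nonneg _) hwn
    _ ≤ K * ((1 + |T|) ^ 13 * Real.exp (-(π * |T| / 2))) := hb
    _ ≤ ε := hT₁ T hTT

/-- **The shift from `re z = 2` to `re z = −1/4`** across the simple pole of `N(z)/z` at `z = 0`
(the tree's strip residue theorem `HuxleyZeroDetection.integral_vertical_sub_eq_of_pole`):
`∫ N(2+iy)/(2+iy) dy − ∫ N(−1/4+iy)/(−1/4+iy) dy = 2π N(0) = 2π (log X₂ − log X₁) g′(0)`.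
[cite: Zhang2022LandauSiegel, §3, proof of Lemma 3.1] -/
theorem integral_numer_shift (hχ1 : χ ≠ 1) (hX₁ : 0 < X₁) (hX₂ : 0 < X₂) :
    (∫ y : ℝ, numer χ X₁ X₂ (2 + y * I) / (2 + y * I - 0)) -
      (∫ y : ℝ, numer χ X₁ X₂ ((-(1 / 4) : ℝ) + y * I) / (((-(1 / 4) : ℝ) : ℂ) + y * I - 0)) =
      2 * π * ((Real.log X₂ - Real.log X₁) * deriv (gFun χ) 0) := by
  have hshift := integral_vertical_sub_eq_of_pole (numer χ X₁ X₂) 0 (a := -(1 / 4)) (b := 2)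
    (by simp) (by simp) ((differentiableOn_numer χ hχ1 hX₁ hX₂).mono fun w hw => by
      simp only [mem_setOf_eq]; have := hw.1.1; linarith)
    (integrable_numer_div_line χ hχ1 hX₁ hX₂ (Or.inl rfl))
    (by simpa using integrable_numer_div_line χ hχ1 hX₁ hX₂ (c := 2) (Or.inr rfl))
    (numer_horizontal_decay χ hχ1 hX₁ hX₂)
  rw [numer_zero χ hX₁ hX₂] at hshift
  simpa using hshift

/-- **Explicit formula for the smoothed logarithmic second moment of `ν = 1 ∗ χ`** (`χ` quadratic,
`χ ≠ 1`, mod `D ≥ 1`; `0 < X₁`, `0 < X₂`):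
`W_{ν²}(X₂) − W_{ν²}(X₁) = g(0)(W_d(X₂) − W_d(X₁)) + (log X₂ − log X₁) g′(0)
  + (1/2π) ∫ N(−1/4+iy)/(−1/4+iy) dy`,
where `W_f(X) = ∑_{n≥1} f(n) n^{-1} e^{-n/X}`, `g(z) = L(1+z,χ)² φ(1+z)`,
`N(z)/z = ζ(1+z)² Γ(z)(X₂^z − X₁^z)(g(z) − g(0))`. This is the contour-shift skeleton of the proof
of Zhang's Lemma 3.1 (there with `X₁ = D⁴`, `X₂ = P²`).
[cite: Zhang2022LandauSiegel, §3, proof of Lemma 3.1] -/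
theorem explicit_formula (hχ : χ ^ 2 = 1) (hχ1 : χ ≠ 1) (hX₁ : 0 < X₁) (hX₂ : 0 < X₂) :
    W (fun n => divisorSumChar χ n ^ 2) X₂ - W (fun n => divisorSumChar χ n ^ 2) X₁ =
      gFun χ 0 * (W dCoeff X₂ - W dCoeff X₁) +
      (Real.log X₂ - Real.log X₁) * deriv (gFun χ) 0 +
      (1 / (2 * π)) * ∫ y : ℝ, numer χ X₁ X₂ ((-(1 / 4) : ℝ) + y * I) /
        (((-(1 / 4) : ℝ) : ℂ) + y * I - 0) := by
  have hshift := integral_numer_shift χ hχ1 hX₁ hX₂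
  obtain ⟨-, h2⟩ := integral_numer_line_two χ hχ hX₁ hX₂
  rw [h2] at hshift
  have hπ : (π : ℂ) ≠ 0 := ofReal_ne_zero.2 Real.pi_pos.ne'
  field_simp
  linear_combination hshift

end Literature.NumberTheory.LFunctions.DivisorSumCharSq

end
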